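import Summits.FinalStateConjecture.FinalStateConjecture.Theses.DissipativeFinalMotions
import Summits.FinalStateConjecture.FinalStateConjecture.Theorems.DissipativeFinalMotionsDispersingCaptureStubAsymptoticVelocity
import Summits.FinalStateConjecture.FinalStateConjecture.Theorems.DissipativeFinalMotionsDispersingCaptureStubCaptureNoHoles
import Summits.FinalStateConjecture.FinalStateConjecture.Theorems.DissipativeFinalMotionsDispersingCaptureStubSeparation
import Summits.FinalStateConjecture.FinalStateConjecture.Theorems.DissipativeFinalMotionsDispersingCaptureStubBoostTransport
import Summits.FinalStateConjecture.FinalStateConjecture.Theorems.DissipativeFinalMotionsDispersingCaptureStubOrientedAssembly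
import HarnessLib

/-!
# PROPOSED RESTATEMENT (rev 4) of crux stmt-FinalStateConjecture-17643 `DispersingCapture`, WITH ITS PROOF
# MODULO THE GR INPUT E — lead prover c2, 2026-08-17 (crux workfile `Restatement_c2.lean`; for the planner)

`DispersingCapture₄` below is the current crux (rev 3) with SIX extra hypotheses inserted between the
package `IsFinalEra₂ …` and (R) — the rest-frame Statement-shaped settled data of Restatement.lean option
(b), stated over the package's OWN binders `B₀, B, Ψ₀, Ψ, O, T, ξ` plus two new binders `ρ : ℝ → ℝ`
(drifting tube profile) and `R : Fin N → ℝ → ℝ` (honest growing near-zone radii):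

* (S1) `ρ(t)/t → 0`;
* (S2) `B₀.domain ⊇ {t > T} ∖ ⋃ᵢ {distᵢ ≤ ρ(t)}` (with (B) `B₀ = Minkowski.backgroundOn U₀` this is (F2)
  with the constant `ρ₀` replaced by the drifting profile `ρ`);
* (S3) FULL-slab `C²` flatness `deviationCk B₀ Ψ₀ 2 τ → 0` (replaces the far-restricted (F3) as the input
  the capture step consumes; (F3) may stay in the package);
* (S4) honest radii `Rᵢ → ∞`, `Rᵢ(τ) ≥ max(r₊(Mᵢ,aᵢ),0) + 1`;
* (S5) near-zone convergence out to the growing radii, `truncDeviationCk (B i) (Ψ i) 2 (Rᵢ τ) τ → 0`;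
* (S6) exhaustion of `O` for every `τ₁ > T` by `Ψ₀({t > τ₁})` and the GROWING zones
  `Ψᵢ({t*ᵢ > τ₁, rᵢ ≤ Rᵢ(t*ᵢ)})` up to `J⁻(Ψ₀({t = τ₁}) ∪ ⋃ᵢ Ψᵢ({t*ᵢ = τ₁, rᵢ ≤ Rᵢ(τ₁)}))` — verbatim
  `certifiedLate`/`certifiedSlab` of `HasExhaustiveCharts` with motions `(1, 0)` ((EX) is the special case
  `Rᵢ ≡ 2ρ₀`);

and with (F₀) stated on WHOLE flat slabs (no `ϱ₀`). Everything else is token-for-token rev 3.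

`dispersingCapture₄_of_escapeRate : Sig.stub_escapeRate → DispersingCapture₄` is a REAL PROOF (no sorry):
`N = 0` by the landed B₀ `stub_captureNoHoles` (p146009); `N = n + 1` by the landed A
`stub_asymptoticVelocity` (p145569), B_sep `stub_separation` (p149503), B₂a `stub_boostTransport`
(p149957) and B₂b `stub_orientedAssembly` (p149167), the rest-frame settled data being now a repackaging
of hypotheses (`T₁ := T`, `U₁ := U₀`, `Φ₀ := Ψ₀` after substituting (B)). So: IF the planner adopts
`DispersingCapture₄` as rev 4 of the crux (and moves (S1)–(S6), full (F₀) into `FinalEraGeneric`'s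
existential, where they are physics anyway), the crux is CLOSED MODULO E = `stub_escapeRate` (the
integrable escape rate / momentum balance for `N ≥ 2`, a conjecture-level GR input to be filed as such).
The E used here is the rev-3 signature; it applies verbatim because rev 4 only ADDS hypotheses.
-/

set_option linter.dupNamespace false

noncomputable section

open scoped Manifold ContDiff Topology
open Filter Set Function MeasureTheory Literature.Geometry.Lorentzian

namespace Summit.FinalStateConjecture.FinalStateConjecture.Cruxes.DispersingCapture.Restated

open Summit.FinalStateConjecture.FinalStateConjecture.Theorems.DissipativeFinalMotions.DispersingCapture
  (stub_asymptoticVelocity stub_captureNoHoles stub_separation stub_boostTransport stub_orientedAssembly)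

/-- Statement of the GR input E (`stub_escapeRate`, registered stub of the line; rev-3 hypotheses). -/
def Sig.stub_escapeRate : Prop :=
  open scoped Manifold Topology in ∀ (X : Type) [TopologicalSpace X] [ChartedSpace (EuclideanSpace ℝ (Fin 3)) X] [IsManifold (𝓡 3) ((⊤ : ℕ∞) : WithTop ℕ∞) X] [T2Space X] [SecondCountableTopology X] [ConnectedSpace X], ∀ (D : Literature.Geometry.Lorentzian.InitialDataSet (𝓡 3) X), D ∈ Literature.Geometry.Lorentzian.admissibleVacuumData X → ∀ (𝒟 : Literature.Geometry.Lorentzian.VacuumCauchyDevelopment D), 𝒟.IsMaximal → Summit.FinalStateConjecture.HasCompleteNullInfinity 𝒟.toCauchyDevelopment → ∀ (N : ℕ) (M a : Fin N → ℝ) (T δ V C₁ C₂ ρ₀ κ : ℝ) (ξ : Fin N → ℝ → EuclideanSpace ℝ (Fin 3)) (β : ℝ → ℝ) (U₀ : TopologicalSpace.Opens Literature.Geometry.Lorentzian.E4) (B₀ : Literature.Geometry.Lorentzian.ModelBackground) (B : Fin N → Literature.Geometry.Lorentzian.ModelBackground) (Ψ₀ : B₀.domain → 𝒟.carrier) (Ψ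 : (i : Fin N) → (B i).domain → 𝒟.carrier) (O : Set 𝒟.carrier), 𝒟.toCauchyDevelopment.IsFinalEra₂ N M a T δ V C₁ C₂ ρ₀ κ ξ β U₀ B₀ B Ψ₀ Ψ O → Summit.FinalStateConjecture.RaysStayInClosure 𝒟.toCauchyDevelopment O → (∀ i (ρ : ℝ), ∀ᶠ τ in Filter.atTop, ∀ x ∈ (B i).truncTimeSlab ρ τ, 𝒟.toSpacetime.timeOrientation.IsFutureDirected (mfderiv 𝓘(ℝ, Literature.Geometry.Lorentzian.E4) (𝓡 4) (Ψ i) x (Literature.Geometry.Lorentzian.Kerr.timeVector (M i) (a i) x.1))) → (∃ ϱ₀ : ℝ, ∀ᶠ τ in Filter.atTop, ∀ x ∈ B₀.timeSlab τ, (∀ i, ϱ₀ ≤ ‖Literature.Geometry.Lorentzian.E4.spatial x.1 - ξ i τ‖) → 𝒟.toSpacetime.timeOrientation.IsFutureDirected (mfderiv 𝓘(ℝ, Literature.Geometry.Lorentzian.E4) (𝓡 4) Ψ₀ x (Literature.Geometry.Lorentzian.E4.basisVector 0))) → (∀ i j, i ≠ j → Filter.Tendsto (fun t ↦ ‖ξ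 i t - ξ j t‖) Filter.atTop Filter.atTop) → ∀ i j, i ≠ j → MeasureTheory.IntegrableOn (fun t ↦ 1 / ‖ξ i t - ξ j t‖ ^ 2) (Set.Ici T)

/-- **PROPOSED rev 4 of the crux `DispersingCapture`** (option (b) of Restatement.lean, made precise): the
rev-3 signature with the binders `ρ : ℝ → ℝ`, `R : Fin N → ℝ → ℝ` appended and the six rest-frame
Statement-shaped clauses (S1)–(S6) inserted after the package, (F₀) on whole flat slabs. -/
def DispersingCapture₄ : Prop :=
  ∀ (X : Type) [TopologicalSpace X] [ChartedSpace (EuclideanSpace ℝ (Fin 3)) X] [IsManifold (𝓡 3) ((⊤ : ℕ∞) : WithTop ℕ∞) X] [T2Space X] [SecondCountableTopology X] [ConnectedSpace X], ∀ (D : Literature.Geometry.Lorentzian.InitialDataSet (𝓡 3) X), D ∈ Literature.Geometry.Lorentzian.admissibleVacuumData X → ∀ (𝒟 : Literature.Geometry.Lorentzian.VacuumCauchyDevelopment D), 𝒟.IsMaximal → Summit.FinalStateConjecture.HasCompleteNullInfinity 𝒟.toCauchyDevelopment → ∀ (N : ℕ) (M a : Fin N → ℝ) (T δ V C₁ C₂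 ρ₀ κ : ℝ) (ξ : Fin N → ℝ → EuclideanSpace ℝ (Fin 3)) (β : ℝ → ℝ) (U₀ : TopologicalSpace.Opens Literature.Geometry.Lorentzian.E4) (B₀ : Literature.Geometry.Lorentzian.ModelBackground) (B : Fin N → Literature.Geometry.Lorentzian.ModelBackground) (Ψ₀ : B₀.domain → 𝒟.carrier) (Ψ : (i : Fin N) → (B i).domain → 𝒟.carrier) (O : Set 𝒟.carrier) (ρ : ℝ → ℝ) (R : Fin N → ℝ → ℝ),
    𝒟.toCauchyDevelopment.IsFinalEra₂ N M a T δ V C₁ C₂ ρ₀ κ ξ β U₀ B₀ B Ψ₀ Ψ O →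
    -- (S1) sublinear drifting tube profile
    Filter.Tendsto (fun t ↦ ρ t / t) Filter.atTop (nhds 0) →
    -- (S2) the flat domain contains the late half-space minus the drifting tubes
    {y : Literature.Geometry.Lorentzian.E4 | T < y 0 ∧ ∀ i, ρ (y 0) < ‖Literature.Geometry.Lorentzian.E4.spatial y - ξ i (y 0)‖} ⊆ (B₀.domain : Set Literature.Geometry.Lorentzian.E4) →
    -- (S3) full-slab `C²` flatness
    Filter.Tendsto (fun τ ↦ 𝒟.toSpacetime.deviationCk B₀ Ψ₀ 2 τ) Filter.atTop (nhds 0) →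
    -- (S4) honest growing radii
    (∀ i, Filter.Tendsto (R i) Filter.atTop Filter.atTop ∧ ∀ τ, max (Literature.Geometry.Lorentzian.Kerr.rPlus (M i) (a i)) 0 + 1 ≤ R i τ) →
    -- (S5) near-zone convergence out to the growing radii
    (∀ i, Filter.Tendsto (fun τ ↦ 𝒟.toSpacetime.truncDeviationCk (B i) (Ψ i) 2 (R i τ) τ) Filter.atTop (nhds 0)) →
    -- (S6) exhaustion with the growing zones (certifiedLate / certifiedSlab shape, motions (1,0))
    (∀ τ₁, T < τ₁ → O \ (Ψ₀ '' B₀.lateRegion τ₁ ∪ ⋃ i, Ψ i '' {x : (B i).domain | τ₁ < (B i).time x.1 ∧ (B i).radius x.1 ≤ R i ((B i).time x.1)}) ⊆ 𝒟.toSpacetime.metric.causalPast 𝒟.toSpacetime.timeOrientation (Ψ₀ '' B₀.timeSlab τ₁ ∪ ⋃ i, Ψ i '' (B i).truncTimeSlab (R i τ₁) τ₁)) →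
    Summit.FinalStateConjecture.RaysStayInClosure 𝒟.toCauchyDevelopment O →
    (∀ i (ρ' : ℝ), ∀ᶠ τ in atTop, ∀ x ∈ (B i).truncTimeSlab ρ' τ, 𝒟.toSpacetime.timeOrientation.IsFutureDirected (mfderiv 𝓘(ℝ, Literature.Geometry.Lorentzian.E4) (𝓡 4) (Ψ i) x (Literature.Geometry.Lorentzian.Kerr.timeVector (M i) (a i) x.1))) →
    -- (F₀) on whole flat slabs
    (∀ᶠ τ in atTop, ∀ x ∈ B₀.timeSlab τ, 𝒟.toSpacetime.timeOrientation.IsFutureDirected (mfderiv 𝓘(ℝ, Literature.Geometry.Lorentzian.E4) (𝓡 4) Ψ₀ x (Literature.Geometry.Lorentzian.E4.basisVector 0))) →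
    (∀ i j, i ≠ j → Tendsto (fun t ↦ ‖ξ i t - ξ j t‖) atTop atTop) →
    ∃ (O' : Set 𝒟.carrier) (d : Literature.Geometry.Lorentzian.FinalStateDecomposition 𝒟.toSpacetime O' 2), (∀ i, Literature.Geometry.Lorentzian.Kerr.IsSubextremal (d.mass i) (d.spin i)) ∧ O' = Summit.FinalStateConjecture.exteriorOf 𝒟.toCauchyDevelopment d.charted ∧ Summit.FinalStateConjecture.RaysStayInClosure 𝒟.toCauchyDevelopment O' ∧ Summit.FinalStateConjecture.HasExhaustiveCharts d ∧ Summit.FinalStateConjecture.IsFutureOriented d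

/-- **The proposed rev 4 holds modulo the GR input E** (real proof from the landed A, B₀, B_sep, B₂a,
B₂b). `N = 0`: B₀ with the package, (R) and (F₀) (whole-slab (F₀) implies the far form with `ϱ₀ := 0`).
`N = n + 1`: E gives the escape rates at the crux's binders (its extra hypothesis, far (F₀), follows from
whole-slab (F₀)); the worldline clauses (5, 12, 13, 14, 15, 17) + the rates feed A (velocities `vᵢ`,
`‖vᵢ‖ ≤ V`, Cesàro); after substituting (B) for `B₀` and `B`, the rest-frame settled data are the
hypotheses (F1), (H1), (S1)–(S6), (O), full (F₀) with `T₁ := T`, `U₁ := U₀`, `Φ₀ := Ψ₀`; B_sep gives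
separation at every radius; B₂a transports to the boosted exteriors of the pure boosts of the `vᵢ`
(`V < 1` is clause 7); B₂b assembles (sub-extremality is clause 4). -/
theorem dispersingCapture₄_of_escapeRate : Sig.stub_escapeRate → DispersingCapture₄ := by
  intro hE X _ _ _ _ _ _ D hD 𝒟 hmax hscri N
  cases N with
  | zero =>
    intro M a T δ V C₁ C₂ ρ₀ κ ξ β U₀ B₀ B Ψ₀ Ψ O _ρ _R hera _hS1 _hS2 _hS3 _hS4 _hS5 _hS6 hrays _hholes
      hflat _hdisp
    exact stub_captureNoHoles X D 𝒟 M a T δ V C₁ C₂ ρ₀ κ ξ β U₀ B₀ B Ψ₀ Ψ O hera hrays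
      ⟨0, hflat.mono fun τ h x hx _ ↦ h x hx⟩
  | succ n =>
    intro M a T δ V C₁ C₂ ρ₀ κ ξ β U₀ B₀ B Ψ₀ Ψ O ρ R hera hS1 hS2 hS3 hS4 hS5 hS6 hrays hholes hflat hdisp
    -- the far form of (F₀) required by E (rev-3 signature), from the whole-slab form
    have hflat' : ∃ ϱ₀ : ℝ, ∀ᶠ τ in atTop, ∀ x ∈ B₀.timeSlab τ,
        (∀ i, ϱ₀ ≤ ‖E4.spatial x.1 - ξ i τ‖) →
          𝒟.toSpacetime.timeOrientation.IsFutureDirected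
            (mfderiv 𝓘(ℝ, E4) (𝓡 4) Ψ₀ x (E4.basisVector 0)) :=
      ⟨0, hflat.mono fun τ h x hx _ ↦ h x hx⟩
    -- (E): the GR input — integrable pairwise escape rates of the dispersing era
    have hesc : ∀ i j, i ≠ j → IntegrableOn (fun t ↦ 1 / ‖ξ i t - ξ j t‖ ^ 2) (Ici T) :=
      hE X D hD 𝒟 hmax hscri (n + 1) M a T δ V C₁ C₂ ρ₀ κ ξ β U₀ B₀ B Ψ₀ Ψ O hera hrays hholes hflat'
        hdisp
    -- (B_sep): separation of the rest-frame tubes at every radius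
    have hsep : ∀ R' : ℝ, ∃ τ' : ℝ,
        Pairwise (Function.onFun Disjoint fun i ↦ Ψ i '' (B i).truncLateRegion τ' R') :=
      stub_separation X D 𝒟 (n + 1) M a T δ V C₁ C₂ ρ₀ κ ξ β U₀ B₀ B Ψ₀ Ψ O hera hdisp
    -- the package clauses used directly
    obtain ⟨hO, hB₀, hB, hsub, hδ, -, hV1, -, -, -, -, hC2, hfloor, hLip, hβ, -, hmod, hF1, -, -, hH1,
      -⟩ := hera
    -- (A): asymptotic velocities from the integrable escape rates (landed theorem)
    have hvel : ∀ i, ∃ v : EuclideanSpace ℝ (Fin 3), ‖v‖ ≤ V ∧ Tendsto (deriv (ξ i)) atTop (𝓝 v) ∧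
        Tendsto (fun t : ℝ ↦ t⁻¹ • ξ i t) atTop (𝓝 v) :=
      stub_asymptoticVelocity (n + 1) M T δ V κ ξ β hδ hC2 hfloor hLip hβ hmod hesc
    choose v hv using hvel
    -- substitute the backgrounds: the rest-frame settled data are now hypotheses verbatim
    subst hB₀
    subst hB
    -- (B₂a): transport to the boosted exteriors of the pure boosts of the `vᵢ`
    obtain ⟨mo, ψ, ρexc, hψ, hconvb, hsepb, hρexc, hU₁b, horth, hFb, hOb, hexhb⟩ :=
      stub_boostTransport X D 𝒟 (n + 1) M a T V ξ v O U₀ Ψ₀ Ψ ρ R hV1 (fun i ↦ (hv i).1)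
        (fun i ↦ (hv i).2.2) hH1 hS1 hS2 (fun i ↦ (hS4 i).1) hS5 hsep hO hS6 hholes
    -- (B₂b): assemble the witness
    exact stub_orientedAssembly X D 𝒟 (n + 1) M a T O U₀ Ψ₀ mo ψ ρexc R hsub hF1 hS3 hflat hS4 hψ
      hconvb hsepb hρexc hU₁b horth hFb hOb hexhb hrays

/-! ## Cap-safe variant: the six clauses + whole-slab (F₀) bundled as one Literature-level predicate

The rev-3 signature is already at the gate's signature-length cap (the 31 clauses had to be packed into
`IsFinalEra₂`); the planner may therefore prefer to file the predicate below as a Literature definition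
and restate the crux as `DispersingCapture₄'`. PROPOSED to the gate by lead c2 as
`Literature.Geometry.Lorentzian.CauchyDevelopment.IsRestFrameSettled`
(`Literature/Geometry/Lorentzian/FinalEraRestFrameSettling.lean`, p152071, kind=definition, review-queued);
the copy below is namespace-local (same body) so that this workfile keeps elaborating whatever the verdict.
-/

/-- **Rest-frame Statement-shaped settling data of a final era** (hypothesis predicate; the content of
Restatement.lean option (b)): over the package binders `T, ξ, B₀, B, Ψ₀, Ψ, O` and the new binders `ρ`
(drifting tube profile) and `R` (honest near-zone radii): (S1) `ρ(t)/t → 0`; (S2) `B₀.domain ⊇ {t > T} ∖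
⋃ᵢ {distᵢ ≤ ρ(t)}`; (S3) full-slab `C²` flatness of `Ψ₀`; (S4) `Rᵢ → ∞`, `Rᵢ ≥ max(r₊,0)+1`; (S5) `C²`
convergence of `Ψᵢ` out to `Rᵢ(τ)`; (S6) exhaustion of `O` for every `τ₁ > T` by the flat late region and
the growing zones up to `J⁻` of the certified slab (the `certifiedLate`/`certifiedSlab` shape of
`HasExhaustiveCharts` with motions `(1,0)`); (F₀′) `dΨ₀(∂₀)` eventually future-directed on whole flat
slabs. No printed formulation (final-state picture, Dafermos–Luk arXiv:1710.01722, p. 8, Conj. 1). -/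
def IsRestFrameSettled
    {X : Type} [TopologicalSpace X] [ChartedSpace E3 X] [IsManifold (𝓡 3) ∞ X] [ConnectedSpace X]
    {D : InitialDataSet (𝓡 3) X} (𝒟 : CauchyDevelopment D) (N : ℕ) (M a : Fin N → ℝ) (T : ℝ)
    (ξ : Fin N → ℝ → E3) (B₀ : ModelBackground) (B : Fin N → ModelBackground)
    (Ψ₀ : B₀.domain → 𝒟.carrier) (Ψ : (i : Fin N) → (B i).domain → 𝒟.carrier) (O : Set 𝒟.carrier)
    (ρ : ℝ → ℝ) (R : Fin N → ℝ → ℝ) : Prop :=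
  Tendsto (fun t ↦ ρ t / t) atTop (𝓝 0) ∧
  {y : E4 | T < y 0 ∧ ∀ i, ρ (y 0) < ‖E4.spatial y - ξ i (y 0)‖} ⊆ (B₀.domain : Set E4) ∧
  Tendsto (fun τ ↦ 𝒟.toSpacetime.deviationCk B₀ Ψ₀ 2 τ) atTop (𝓝 0) ∧
  (∀ i, Tendsto (R i) atTop atTop ∧ ∀ τ, max (Kerr.rPlus (M i) (a i)) 0 + 1 ≤ R i τ) ∧
  (∀ i, Tendsto (fun τ ↦ 𝒟.toSpacetime.truncDeviationCk (B i) (Ψ i) 2 (R i τ) τ) atTop (𝓝 0)) ∧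
  (∀ τ₁, T < τ₁ → O \ (Ψ₀ '' B₀.lateRegion τ₁ ∪
      ⋃ i, Ψ i '' {x : (B i).domain | τ₁ < (B i).time x.1 ∧ (B i).radius x.1 ≤ R i ((B i).time x.1)}) ⊆
    𝒟.toSpacetime.metric.causalPast 𝒟.toSpacetime.timeOrientation
      (Ψ₀ '' B₀.timeSlab τ₁ ∪ ⋃ i, Ψ i '' (B i).truncTimeSlab (R i τ₁) τ₁)) ∧
  (∀ᶠ τ in atTop, ∀ x ∈ B₀.timeSlab τ, 𝒟.toSpacetime.timeOrientation.IsFutureDirected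
    (mfderiv 𝓘(ℝ, E4) (𝓡 4) Ψ₀ x (E4.basisVector 0)))

/-- **PROPOSED rev 4, cap-safe form**: rev 3 with the binders `ρ, R` appended, the bundled predicate
`IsRestFrameSettled` inserted after the package, and the far-restricted (F₀) dropped (subsumed). -/
def DispersingCapture₄' : Prop :=
  ∀ (X : Type) [TopologicalSpace X] [ChartedSpace (EuclideanSpace ℝ (Fin 3)) X] [IsManifold (𝓡 3) ((⊤ : ℕ∞) : WithTop ℕ∞) X] [T2Space X] [SecondCountableTopology X] [ConnectedSpace X], ∀ (D : Literature.Geometry.Lorentzian.InitialDataSet (𝓡 3) X), D ∈ Literature.Geometry.Lorentzian.admissibleVacuumData X → ∀ (𝒟 : Literature.Geometry.Lorentzian.VacuumCauchyDevelopment D), 𝒟.IsMaximal → Summit.FinalStateConjecture.HasCompleteNullInfinity 𝒟.toCauchyDevelopment → ∀ (N : ℕ) (M a : Fin N → ℝ) (T δ V C₁ C₂ ρ₀ κ : ℝ) (ξ : Fin N → ℝ → EuclideanSpace ℝ (Fin 3)) (β : ℝ → ℝ) (U₀ : TopologicalSpace.Opens Literature.Geometry.Lorentzian.E4) (B₀ :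 Literature.Geometry.Lorentzian.ModelBackground) (B : Fin N → Literature.Geometry.Lorentzian.ModelBackground) (Ψ₀ : B₀.domain → 𝒟.carrier) (Ψ : (i : Fin N) → (B i).domain → 𝒟.carrier) (O : Set 𝒟.carrier) (ρ : ℝ → ℝ) (R : Fin N → ℝ → ℝ),
    𝒟.toCauchyDevelopment.IsFinalEra₂ N M a T δ V C₁ C₂ ρ₀ κ ξ β U₀ B₀ B Ψ₀ Ψ O →
    IsRestFrameSettled 𝒟.toCauchyDevelopment N M a T ξ B₀ B Ψ₀ Ψ O ρ R →
    Summit.FinalStateConjecture.RaysStayInClosure 𝒟.toCauchyDevelopment O →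
    (∀ i (ρ' : ℝ), ∀ᶠ τ in atTop, ∀ x ∈ (B i).truncTimeSlab ρ' τ, 𝒟.toSpacetime.timeOrientation.IsFutureDirected (mfderiv 𝓘(ℝ, Literature.Geometry.Lorentzian.E4) (𝓡 4) (Ψ i) x (Literature.Geometry.Lorentzian.Kerr.timeVector (M i) (a i) x.1))) →
    (∀ i j, i ≠ j → Tendsto (fun t ↦ ‖ξ i t - ξ j t‖) atTop atTop) →
    ∃ (O' : Set 𝒟.carrier) (d : Literature.Geometry.Lorentzian.FinalStateDecomposition 𝒟.toSpacetime O' 2), (∀ i, Literature.Geometry.Lorentzian.Kerr.IsSubextremal (d.mass i) (d.spin i)) ∧ O' = Summit.FinalStateConjecture.exteriorOf 𝒟.toCauchyDevelopment d.charted ∧ Summit.FinalStateConjecture.RaysStayInClosure 𝒟.toCauchyDevelopment O' ∧ Summit.FinalStateConjecture.HasExhaustiveCharts d ∧ Summit.FinalStateConjecture.IsFutureOriented d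

/-- The cap-safe rev 4 follows from the unbundled one (it IS it, with the seven clauses curried), hence
holds modulo the GR input E. -/
theorem dispersingCapture₄'_of_escapeRate : Sig.stub_escapeRate → DispersingCapture₄' := by
  intro hE X _ _ _ _ _ _ D hD 𝒟 hmax hscri N M a T δ V C₁ C₂ ρ₀ κ ξ β U₀ B₀ B Ψ₀ Ψ O ρ R hera hset
    hrays hholes hdisp
  obtain ⟨hS1, hS2, hS3, hS4, hS5, hS6, hF₀⟩ := hset
  exact dispersingCapture₄_of_escapeRate hE X D hD 𝒟 hmax hscri N M a T δ V C₁ C₂ ρ₀ κ ξ β U₀ B₀ B Ψ₀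
    Ψ O ρ R hera hS1 hS2 hS3 hS4 hS5 hS6 hrays hholes hF₀ hdisp

end Summit.FinalStateConjecture.FinalStateConjecture.Cruxes.DispersingCapture.Restated

end
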